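import Literature.Combinatorics.SimpleGraph.BrinkmannTuckerVanCleemput2021.ClassTwo
import Literature.Combinatorics.SimpleGraph.BrinkmannTuckerVanCleemput2021.Embedding
import Literature.Combinatorics.SimpleGraph.BrinkmannTuckerVanCleemput2021.Girth
import HarnessLib

/-!
# A 70-vertex cubic graph of class 2 with a polyhedral embedding of genus 5

Brinkmann, Tucker and Van Cleemput [BrinkmannTuckerVancleemput2021, §3.1] recall that Kochol
[Kochol2008] disproved Grünbaum's 1969 question (is every cubic graph with a polyhedral embedding in
an orientable surface 3-edge-colourable?) with a 74-vertex example of genus 5, and write: "It is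
neither known whether Kochol's graph is the smallest counterexample nor whether there are
counterexamples with smaller genus."  This module assembles the kernel-checked facts of this
directory into one statement answering the FIRST of the two questions: `G70` is a cubic graph on
`70 < 74` vertices (`…G70`), of girth 5 (`…Girth`), not 3-edge-colourable (`…ClassTwo`), whose
rotation system `rot` is a polyhedral embedding (every facial walk a simple cycle, any two faces
meeting in nothing, one vertex or one edge — Definition 1 of the paper) with `27` faces, hence Euler
characteristic `70 - 105 + 27 = 2 - 2·5`, i.e. genus 5 (`…Embedding`).  So Kochol's graph is not
the smallest counterexample; whether `70` is optimal, and the second question (genus `≤ 4`), remain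
as they were.

Everything is by kernel evaluation / elementary Mathlib reasoning (standard axioms, no
`native_decide`).  Not formalised: the Heffter–Edmonds–Ringel dictionary between rotation systems
and cellular embeddings in surfaces (the statement below is about the combinatorial map, which is
also what the paper's programs check), and cyclic 4-edge-connectivity of `G70` (certified only by
the bundle's stdlib checker).

Provenance: refutations bundle `papers/_cross/refutations` (H21 seat pub-refute-2, 2026-08-18); the
graph comes from the 2001 programme's archive (`g70_map.json`); written for the tree under the
Lean-in-tree rule (human 2026-08-18).
-/

namespace Literature.Combinatorics.SimpleGraph.BrinkmannTuckerVanCleemput2021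

open _root_.SimpleGraph

/-- **A counterexample to Grünbaum's question smaller than Kochol's.**  `G70` has `70 < 74`
vertices, is cubic, has girth `5`, is not 3-edge-colourable (its line graph is not 3-colourable),
and its rotation system is a polyhedral embedding of genus `5`: the `27` listed faces partition the
`210` darts and are the orbits of the face-tracing permutation, every facial walk is a simple cycle,
any two distinct faces meet polyhedrally (Definition 1), and `V - E + F = 2 - 2·5`.
[cite: BrinkmannTuckerVancleemput2021, §3.1] -/
theorem smaller_than_kochol :
    Fintype.card (Fin 70) < 74 ∧ G70.IsRegularOfDegree 3 ∧ G70.girth = 5 ∧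
      ¬ G70.lineGraph.Colorable 3 ∧
      (∀ d : Dart, (faceList.map fun f => f.count d).sum = 1) ∧
      (∀ f ∈ faceList, f ≠ [] ∧ ∀ k : Fin f.length,
        nextDart (f.get k) = f.get ⟨(k + 1) % f.length, Nat.mod_lt _ (Fin.pos k)⟩) ∧
      (∀ f ∈ faceList, 3 ≤ f.length ∧ (fverts f).Nodup) ∧
      (∀ f ∈ faceList, ∀ g ∈ faceList, f ≠ g → MeetPolyhedrally f g) ∧
      faceList.length = 27 ∧ eulerChar = 2 - 2 * 5 :=
  ⟨by simp, isRegularOfDegree_three, girth_eq_five, not_colorable_three, faceList_cover,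
    faceList_orbits, faces_simple, faces_meet, faceList_length, by rw [eulerChar_eq]; decide⟩

end Literature.Combinatorics.SimpleGraph.BrinkmannTuckerVanCleemput2021
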